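import Summits.QuantumFields.BalabanUV.T4Continuum.Support.NE7MinimiserC1StabConst
import Summits.QuantumFields.BalabanUV.T4Continuum.Support.MinimalActionWitness
import HarnessLib

/-!
# NE7MinimiserC1Flat — `U_k(V)` IS `C¹` IN THE DATUM NEAR THE FLAT DATUM, UNCONDITIONALLY (ROAD-G114 §10): the hypothesis (G3) of ✓ `NE7MinimiserC1StabConst.minimiser_contDiffAt_of_stab_const`
# is DISCHARGED at the flat datum `V₀ = 1` with the flat minimiser `U♯ = 1` (every `U(n)`, `L ≥ 2`, `d = 4`): the unitary `N`-periodic gauges fixing `1` are the constant gauges (lattice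
# propagation), and constant gauges fix `1`.  RESULT: over `0 < ε ≤ ε₀`, `N ≥ 1`, every level `j+1`: a `C¹` germ `Ψ`, `Ψ(0) = 0`, with `chart_1 Ψ(y)` a minimiser over the datum
# `chart_1 y = e^{y}` for all small `y`, and `y ↦ minAct(e^{y})` `C¹` at `0` — the expansion point of the renormalisation group

Cell `pub-balaban`, rung (B)+1 sub-cell t4, lineage `b2b-balaban-t4-ne7-p1` (CRUX PROVER NE7 #1 = OWNER of BINDER row NE7), generation 114.  Memo `t4/b2b-balaban-t4-ne7-p1-g114/ROAD-G114.md` §10.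
WHAT ([folklore]; 0 def, 0 sorry).  `stab_flatCfg_const`, **`minimiser_contDiffAt_flat`**.
HONEST FRAMING (page 1): composition of landed kernel theorems; radii existential; `C¹`, NOT the analyticity [B11] p.279 asserts; nothing of Bałaban's asserted; NOT NE7 as a spine node,
NOT NE3; spine 0∕9; finite T⁴ rung (B)+1 — NOT infinite volume, NOT mass gap, NOT BetaPertH, NOT Clay.
-/

set_option autoImplicit false

open scoped BigOperators Matrix Matrix.Norms.L2Operator Topology
open NormedSpace Finset Set Filter Metric

namespace Summit.QuantumFields.BalabanUV.T4Continuum.NE7MinimiserC1Flat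

open Literature.MathematicalPhysics.QuantumFieldTheory.Balaban1983to89
open B7Prop1Explicit B7Prop2Explicit
open T4AveragingDeficitWall (IsUnitaryCfg SmallField)
open T4AveragingDeficitWallBoundary (IsPeriodicCfg)
open AveragingDeficitTorusChart (TDir chart redN)
open AveragingDeficitTwoLevelPrep (skewSub)
open AveragingDeficitMultiLevelPrep (tower)
open MinimalActionSandwich (IsMinimiser minAct) open MinimalActionRate (sfClass)
open NE3EnergyShapes (IsUnitarySite IsPeriodicSite)
open MinimalActionWitness (flatCfg isMinimiser_sfClass_flatCfg flatCfg_mem_sfClass isPeriodicCfg_flatCfg)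
open NE7CovariantConstancyBox (eq_zero_of_propagate)
open NE7NearStabiliserTorus (site_eq_wrap)
open NE7MinimiserC1StabConst (minimiser_contDiffAt_of_stab_const)

noncomputable section

variable {n : Type} [Fintype n] [DecidableEq n]

/-- The `N`-periodic gauges fixing the flat configuration are the constant gauges. [folklore] -/
theorem stab_flatCfg_const {N : ℕ} [NeZero N] {s : Site 4 → (Matrix n n ℂ)ˣ} (hsP : IsPeriodicSite s (N : ℤ))
    (hfix : gaugeAct s (flatCfg : Site 4 → Fin 4 → (Matrix n n ℂ)ˣ) = flatCfg) (z : Site 4) : s z = s 0 := by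
  have hstep : ∀ (y : Site 4) (κ : Fin 4), s (y + e κ) = s y := fun y κ => by
    have h := congr_fun (congr_fun hfix y) κ
    simp only [gaugeAct, flatCfg, mul_one] at h
    calc s (y + e κ) = (s y * (s (y + e κ))⁻¹)⁻¹ * s y := by group
      _ = s y := by rw [h, inv_one, one_mul]
  have hbox : ∀ r : Fin 4 → Fin N, s (boxVec N r) = s 0 := by
    refine eq_zero_of_propagate N (P := fun r => s (boxVec N r) = s 0) ?_ ?_
    · have h0 : boxVec N (fun _ : Fin 4 => (⟨0, Nat.pos_of_ne_zero (NeZero.ne N)⟩ : Fin N)) = (0 : Site 4) := by funext i; simp [boxVec]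
      rw [h0]
    · intro r i hr; rw [← site_eq_wrap hsP (boxVec N r + e i), hstep, hr]
  rw [site_eq_wrap hsP z]; exact hbox _

/-- **`U_k(V)` IS `C¹` IN `V` NEAR THE FLAT DATUM, AND SO IS THE MINIMAL ACTION** (unconditional; see the module docstring). [folklore] -/
theorem minimiser_contDiffAt_flat [Nonempty n] {L : ℕ} [NeZero L] (hL : 2 ≤ L) :
    ∃ ε₀ : ℝ, 0 < ε₀ ∧ ∀ ε : ℝ, 0 < ε → ε ≤ ε₀ → ∀ (N : ℕ) [NeZero N], 1 ≤ N → ∀ j : ℕ,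
      ∃ Ψ : ↥(skewSub 4 n N) → ↥(skewSub 4 n (L * tower L N j)), ContDiffAt ℝ 1 Ψ 0 ∧ Ψ 0 = 0 ∧
        (∀ᶠ y : ↥(skewSub 4 n N) in 𝓝 0, IsMinimiser 4 (sfClass 4 L N ε) L N (j + 1)
          (chart (ContinuousLinearMap.id ℝ (Matrix n n ℂ)) N (flatCfg : Site 4 → Fin 4 → (Matrix n n ℂ)ˣ) (y : TDir 4 n N))
          (chart (ContinuousLinearMap.id ℝ (Matrix n n ℂ)) (L * tower L N j) (flatCfg : Site 4 → Fin 4 → (Matrix n n ℂ)ˣ)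
            ((Ψ y : ↥(skewSub 4 n (L * tower L N j))) : TDir 4 n (L * tower L N j)))) ∧
        ContDiffAt ℝ 1 (fun y : ↥(skewSub 4 n N) => minAct 4 (sfClass 4 L N ε) L N (j + 1)
          (chart (ContinuousLinearMap.id ℝ (Matrix n n ℂ)) N (flatCfg : Site 4 → Fin 4 → (Matrix n n ℂ)ˣ) (y : TDir 4 n N))) 0 := by
  have hL1 : 1 ≤ L := by omega
  obtain ⟨ε₀, hε₀, H⟩ := minimiser_contDiffAt_of_stab_const (n := n) hL
  refine ⟨ε₀, hε₀, fun ε hε hεle N _ hN j => ?_⟩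
  obtain ⟨δV, hδV, H1⟩ := H ε hε hεle N hN
  have hsmall : SmallField (flatCfg : Site 4 → Fin 4 → (Matrix n n ℂ)ˣ) δV := by
    have h := (flatCfg_mem_sfClass (d := 4) (n := n) L N hδV.le 0).2.2
    simpa using h
  have hV₀ : (flatCfg : Site 4 → Fin 4 → (Matrix n n ℂ)ˣ) ∈ {V : Site 4 → Fin 4 → (Matrix n n ℂ)ˣ | IsUnitaryCfg V ∧ IsPeriodicCfg V (N : ℤ) ∧ SmallField V δV} :=
    ⟨(flatCfg_mem_sfClass (d := 4) (n := n) L N hε.le 0).1, isPeriodicCfg_flatCfg _, hsmall⟩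
  have hgen : ∀ s : Site 4 → (Matrix n n ℂ)ˣ, IsUnitarySite s → IsPeriodicSite s (N : ℤ) → gaugeAct s (flatCfg : Site 4 → Fin 4 → (Matrix n n ℂ)ˣ) = flatCfg →
      (∀ z : Site 4, s z = s 0) ∧ gaugeAct (fun _ : Site 4 => s 0) (flatCfg : Site 4 → Fin 4 → (Matrix n n ℂ)ˣ) = flatCfg := fun s _ hsP hfix =>
    ⟨stab_flatCfg_const hsP hfix, by funext x κ; simp only [gaugeAct, flatCfg, mul_one, mul_inv_cancel]⟩
  exact H1 flatCfg hV₀ j flatCfg (isMinimiser_sfClass_flatCfg hL1 N hε.le (j + 1)) hgen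

end

end Summit.QuantumFields.BalabanUV.T4Continuum.NE7MinimiserC1Flat
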